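import Summits.QuantumFields.YangMills.Theorems.BalabanUVNodesK0Stub1V0SlotAtRecordLevels
import Summits.QuantumFields.YangMills.Theorems.BalabanUVNodesK0Stub1SectFMultiplierFormAnalytic
import HarnessLib

/-!
# K0⁷ STUB 1 (`stub_prop8StepCoP13`), sub-target S4b «the (δ∕δA′)V pieces at objects», brick 9:
# **g0's V₀-CURRENT IN THE FRÉCHET CURRENCY OF BRICK 8** — the pairing (27) on the Setup torus `PBond P 0 → 𝔸` as a continuous bilinear map `BE`,
# the entire function `Y ↦ V₀(Y)` of (26) at the flat background, and `D(V₀)(Y) = BE(W₀ Y, ·)` for the current `W₀` of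
# `K0Stub1V0SlotAtRecord.exists_W_V0_flat` (p587784), read off its (63)-certificate along lines — the hypothesis `hΦ` of brick 8's
# `hasFDerivAt_comp_chart47C_pair` ∕ `hasFDerivAt_sectF_VC_pair` at the chart point

Cell `pub-ymgap`, width seat `pub-ymgap-k0-s1-w2` g2 (director-ym №197 ∕ HUMAN RULING D-0149; plan g77–g81 W-SEAT-START-LIST §k0-s1, w2 ↦ S4b).
`--kind proof --supports stmt-QuantumFields-20541 --as helper`; count-neutral.  [15] = [Balaban1985Variational].

WHY.  Brick 8 (`K0Stub1SectFMultiplierFormAnalytic`) assembles Sect. F's `W = (δ∕δA′)V` over `ℂ` from the `H`-groups and a «V₀-functional» `Φ₀` whose derivative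
at the chart point is `BE(g₀, ·)` for a bilinear pairing `BE`.  g0's file (`K0Stub1V0SlotAtRecord.exists_W_V0_flat`) delivers the V₀-current `W₀` on `PBond P 0 → 𝔸`
with the certificate *along lines*: «`bondPair η d τ (W₀ Y) δ = (d∕dt)V₀(Y + tδ)|₀`» for pv27's `V₀` of (26) at the flat background `1` and the shifts of the
Setup torus.  THIS FILE turns that into the Fréchet statement brick 8 consumes: (i) the pairing (27) `⟨A, E⟩ = η^d Σ_x Σ_μ τ(A_μ(x)E_μ(x))` read on
`PBond P 0 → 𝔸` IS a continuous bilinear map (finite lattice, finite-dimensional fibre); (ii) `V₀` is an entire function of the configuration for ANY shift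
structure (lit-balaban's `differentiable_V0` is stated for its own torus `Tsh`; the proof — (30) `V₀ = Σ_p η^d V₀(·, ∂p)` and `Cⁿ`-regularity of each
`V₀(·, ∂p)` — is shift-generic); (iii) line certificate + differentiability ⇒ `D(V₀)(Y) = BE(W₀ Y, ·)` (brick 8 `hasFDerivAt_of_line_certificate`).

WHAT IS PROVED (sorry-free; no definition; axioms standard).
* §1 `differentiable_V0_of_shifts` — `V₀ T U η d τ` of (26) is `ℂ`-differentiable on `ι → S → 𝔸` for EVERY family of shifts `T : ι → Equiv.Perm S`, every background `U`,
  tracial continuous `τ`, `η ≠ 0`, `d ≥ 4` (lit-balaban `eq30a` + `contDiff_V0p`, shift-generic).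
* §2 `exists_bondPairCLM` — `∃ BE : (PBond P j → 𝔸) →L[ℂ] (PBond P j → 𝔸) →L[ℂ] ℂ, BE Y δ = bondPair η d τ (Y read as `μ x ↦ Y⟨x,μ⟩`) (δ likewise)` (finite dimension).
* §3 ★ `hasFDerivAt_V0_of_line_certificate` — for ANY `W₀` with g0's certificate at `Y` and any such `BE`: `HasFDerivAt (Y ↦ V₀[shifts, 1](Y)) (BE (W₀ Y)) Y`.
* §4 ★★ `exists_V0_current_frechet_flat` — g0's `exists_W_V0_flat` REPACKAGED: `∃ e W₀ BE`, the dictionary law, `W₀`'s defining equation (lit-balaban's `curV0 ρ τ 1` read through `e`), `BE` = (27), g0's pointwise (98)-slot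
  (`r < 1/16 ⇒ ‖W₀ Y b‖ ≤ (d−1)‖ρ‖(64+138‖τ‖)·r²`), `Differentiable ℂ W₀`, AND `∀ Y, HasFDerivAt V₀ (BE (W₀ Y)) Y` — the `(Φ₀, g₀, BE)`-input of brick 8 at every
  chart point, one level `k`, every `Params` with `4 ≤ d`; ★★ `exists_V0_current_frechet_flat_levOf` — the same with the record's MULTI-LEVEL weights
  `w m b = ((L^{j(b)})·L^{−k})^m` on any one-step-collared `Ω` (g0's `…V0SlotAtRecordLevels.exists_W_V0_flat_levOf`, the weights of k0-s1-w1's `_recordDom`).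
HONEST SCOPE.  Packaging and calculus BY NAME over g0's files and lit-balaban's (26)∕(30); the fibre letters `ρ, τ` stay displayed; nothing of [15]'s analysis asserted; `stub_prop8StepCoP13` ∕ K0⁷ NOT closed; N07 NOT discharged; counts unmoved
(28∕28 · 5∕27); one finite 𝕋⁴ programme at fixed ε — R4 closes the conditional finite-𝕋⁴ rung `BalabanLadder.UV` only, never the summit; the YM mass gap (Clay) is
NOT proved by any of this; nothing continuum ∕ ℝ⁴ ∕ OS.  No `sorry`, no `def`, no `instance`, no `notation`.

References: [15] (26)–(27) p.282, (30) p.282, (63) p.287, (90)–(96) pp.291–292, (98) p.293, (157)–(158) p.302.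
-/

set_option autoImplicit false

noncomputable section

namespace Summit.QuantumFields.YangMills.Theorems.K0Stub1V0CurrentFrechet

open Literature.MathematicalPhysics.QuantumFieldTheory.Balaban1983to89
open B4Sect5Torus (TSite)
open B9Eq39Adjoint (bondPair posPlaq)
open B11Eq26ActionExpansion (V0 eq30a)
open B9SectCLatticeCarrier (Bond)
open B11Eq115Space (NegSup JetSup levOf)
open B11Eq111FrakG (nabla115)
open B11Eq63V0GroupCurrent (curV0)
open B11Eq90V0primeBond (contDiff_V0p)
open Summit.QuantumFields.YangMills.Theorems.K0Stub1SectFMultiplierFormAnalytic (hasFDerivAt_of_line_certificate)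
open Summit.QuantumFields.YangMills.Theorems.K0Stub1V0SlotAtRecord (exists_W_V0_flat)
open Summit.QuantumFields.YangMills.Theorems.K0Stub1V0SlotAtRecordLevels (exists_W_V0_flat_levOf)

/-! ## §1  `V₀` of (26) is an entire function of the configuration, for every shift structure -/

section Entire

variable {𝔸 : Type*} [NormedRing 𝔸] [NormedAlgebra ℂ 𝔸] [CompleteSpace 𝔸]
variable {S : Type*} [Fintype S] {ι : Type*} [Fintype ι] [LinearOrder ι]

/-- **`V₀` IS ENTIRE** (p. 282: «an analytic, and even an entire function of A»), for EVERY family of shifts `T`, background `U`, tracial continuous `τ`,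
`η ≠ 0`, `d ≥ 4`: by (30) `V₀(A) = Σ_p η^d V₀(A, ∂p)` (lit-balaban `eq30a`) and the `Cⁿ`-regularity of each `V₀(·, ∂p)` (`contDiff_V0p`) — the proof of
lit-balaban's `B11Eq90V0GroupComposed.differentiable_V0`, read shift-generically (so it applies to the Setup torus' `shiftEquiv`).
[cite: Balaban1985Variational, p.282, (30) p.282] -/
theorem differentiable_V0_of_shifts (T : ι → Equiv.Perm S) (U : ι → S → 𝔸ˣ) (τ : 𝔸 →L[ℂ] ℂ) (hτ : ∀ a b : 𝔸, τ (a * b) = τ (b * a))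
    {η : ℝ} (hη : η ≠ 0) {d : ℕ} (hd : 4 ≤ d) :
    Differentiable ℂ (V0 T U η d (τ : 𝔸 →ₗ[ℂ] ℂ) : (ι → S → 𝔸) → ℂ) := by
  have e : (V0 T U η d (τ : 𝔸 →ₗ[ℂ] ℂ) : (ι → S → 𝔸) → ℂ)
      = fun A => ∑ q ∈ posPlaq S ι, (η : ℂ) ^ d * B11Eq26ActionExpansion.V0p T U η (τ : 𝔸 →ₗ[ℂ] ℂ) A q.2.1 q.2.2 q.1 :=
    funext fun A => eq30a T U (τ : 𝔸 →ₗ[ℂ] ℂ) hτ η hη hd A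
  rw [e]
  exact Differentiable.fun_sum fun q _ => (((contDiff_V0p T U (n := 1) η τ q.2.1 q.2.2 q.1).differentiable one_ne_zero).const_mul _)

end Entire

/-! ## §2  The pairing (27) on `PBond P j → 𝔸` as a continuous bilinear map -/

section Pairing

variable {P : Params} {𝔸 : Type*} [NormedRing 𝔸] [NormedAlgebra ℂ 𝔸] [FiniteDimensional ℂ 𝔸]

/-- **THE PAIRING (27) `⟨A, E⟩ = η^d Σ_x Σ_μ τ(A_μ(x)E_μ(x))` READ ON `PBond P j → 𝔸` IS A CONTINUOUS BILINEAR MAP** (finite lattice, finite-dimensional fibre) —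
packaged as an existence statement with its defining equation (the file declares no definition). [cite: Balaban1985Variational, (27) p.282] -/
theorem exists_bondPairCLM (j : ℕ) (η : ℝ) (d : ℕ) (τ : 𝔸 →ₗ[ℂ] ℂ) :
    ∃ BE : (PBond P j → 𝔸) →L[ℂ] (PBond P j → 𝔸) →L[ℂ] ℂ,
      ∀ Y δ : PBond P j → 𝔸, BE Y δ = bondPair η d τ (fun μ x => Y ⟨x, μ⟩) (fun μ x => δ ⟨x, μ⟩) := by
  classical
  let Bₗ : (PBond P j → 𝔸) →ₗ[ℂ] (PBond P j → 𝔸) →ₗ[ℂ] ℂ :=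
    LinearMap.mk₂ ℂ (fun Y δ => bondPair η d τ (fun μ x => Y ⟨x, μ⟩) (fun μ x => δ ⟨x, μ⟩))
      (fun Y Y' δ => by
        simp only [bondPair, Pi.add_apply, add_mul, map_add, Finset.sum_add_distrib, mul_add])
      (fun c Y δ => by
        simp only [bondPair, Pi.smul_apply, smul_mul_assoc, map_smul, smul_eq_mul, Finset.mul_sum]
        exact Finset.sum_congr rfl fun x _ => Finset.sum_congr rfl fun μ _ => by ring)
      (fun Y δ δ' => by
        simp only [bondPair, Pi.add_apply, mul_add, map_add, Finset.sum_add_distrib])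
      (fun c Y δ => by
        simp only [bondPair, Pi.smul_apply, mul_smul_comm, map_smul, smul_eq_mul, Finset.mul_sum]
        exact Finset.sum_congr rfl fun x _ => Finset.sum_congr rfl fun μ _ => by ring)
  let B₁ : (PBond P j → 𝔸) →ₗ[ℂ] ((PBond P j → 𝔸) →L[ℂ] ℂ) :=
    (LinearMap.toContinuousLinearMap : ((PBond P j → 𝔸) →ₗ[ℂ] ℂ) ≃ₗ[ℂ] ((PBond P j → 𝔸) →L[ℂ] ℂ)).toLinearMap ∘ₗ Bₗ
  exact ⟨LinearMap.toContinuousLinearMap B₁, fun Y δ => rfl⟩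

end Pairing

/-! ## §3  Line certificate + differentiability ⇒ the Fréchet form `D(V₀)(Y) = BE(W₀ Y, ·)` -/

section Frechet

variable {P : Params} {𝔸 : Type*} [NormedRing 𝔸] [NormedAlgebra ℂ 𝔸] [CompleteSpace 𝔸] [FiniteDimensional ℂ 𝔸]

/-- ★ **g0's (63)-CERTIFICATE ALONG LINES, IN FRÉCHET FORM**: for ANY map `W₀` on `PBond P 0 → 𝔸` with
«`bondPair η d τ (W₀ Y) δ = (d∕dt)V₀[shifts, 1](Y + tδ)|₀` for all `δ`» (the last conjunct of `K0Stub1V0SlotAtRecord.exists_W_V0_flat`) and ANY continuous bilinear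
`BE` agreeing with the pairing (27): `HasFDerivAt (Y ↦ V₀[shifts, 1](Y)) (BE (W₀ Y)) Y` — tracial continuous `τ`, `η ≠ 0`, `d ≥ 4` (entire `V₀`, §1), brick 8's
`hasFDerivAt_of_line_certificate`. [cite: Balaban1985Variational, (63) p.287, (26)–(27) p.282, (90) p.291] -/
theorem hasFDerivAt_V0_of_line_certificate (hd : 4 ≤ P.d) {η : ℝ} (hη : η ≠ 0) (τ : 𝔸 →L[ℂ] ℂ) (hτ : ∀ a b : 𝔸, τ (a * b) = τ (b * a))
    (BE : (PBond P 0 → 𝔸) →L[ℂ] (PBond P 0 → 𝔸) →L[ℂ] ℂ)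
    (hBE : ∀ Y δ : PBond P 0 → 𝔸, BE Y δ = bondPair η P.d (τ : 𝔸 →ₗ[ℂ] ℂ) (fun μ x => Y ⟨x, μ⟩) (fun μ x => δ ⟨x, μ⟩))
    (W₀ : (PBond P 0 → 𝔸) → (PBond P 0 → 𝔸)) (Y : PBond P 0 → 𝔸)
    (hcert : ∀ δ : PBond P 0 → 𝔸,
      bondPair η P.d (τ : 𝔸 →ₗ[ℂ] ℂ) (fun μ x => W₀ Y ⟨x, μ⟩) (fun μ x => δ ⟨x, μ⟩)
        = deriv (fun t : ℂ => V0 (LatticeFieldCalculus.shiftEquiv (P := P) (j := 0)) (fun _ _ => (1 : 𝔸ˣ)) η P.d (τ : 𝔸 →ₗ[ℂ] ℂ)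
            ((fun μ x => Y ⟨x, μ⟩) + t • fun μ x => δ ⟨x, μ⟩)) 0) :
    HasFDerivAt (fun Y' : PBond P 0 → 𝔸 =>
        V0 (LatticeFieldCalculus.shiftEquiv (P := P) (j := 0)) (fun _ _ => (1 : 𝔸ˣ)) η P.d (τ : 𝔸 →ₗ[ℂ] ℂ) (fun μ x => Y' ⟨x, μ⟩))
      (BE (W₀ Y)) Y := by
  -- the reading `Y ↦ (μ x ↦ Y⟨x,μ⟩)` is a continuous linear map
  let Rₗ : (PBond P 0 → 𝔸) →ₗ[ℂ] (Fin P.d → Site P 0 → 𝔸) :=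
    { toFun := fun Y' μ x => Y' ⟨x, μ⟩
      map_add' := fun _ _ => rfl
      map_smul' := fun _ _ => rfl }
  let R : (PBond P 0 → 𝔸) →L[ℂ] (Fin P.d → Site P 0 → 𝔸) := LinearMap.toContinuousLinearMap Rₗ
  have hR : ∀ Y' : PBond P 0 → 𝔸, (R Y' : Fin P.d → Site P 0 → 𝔸) = fun μ x => Y' ⟨x, μ⟩ := fun _ => rfl
  have hV := differentiable_V0_of_shifts (LatticeFieldCalculus.shiftEquiv (P := P) (j := 0)) (fun _ _ => (1 : 𝔸ˣ)) τ hτ hη hd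
  have hΦ : Differentiable ℂ (fun Y' : PBond P 0 → 𝔸 =>
      V0 (LatticeFieldCalculus.shiftEquiv (P := P) (j := 0)) (fun _ _ => (1 : 𝔸ˣ)) η P.d (τ : 𝔸 →ₗ[ℂ] ℂ) (fun μ x => Y' ⟨x, μ⟩)) := by
    have e : (fun Y' : PBond P 0 → 𝔸 =>
        V0 (LatticeFieldCalculus.shiftEquiv (P := P) (j := 0)) (fun _ _ => (1 : 𝔸ˣ)) η P.d (τ : 𝔸 →ₗ[ℂ] ℂ) (fun μ x => Y' ⟨x, μ⟩))
        = (V0 (LatticeFieldCalculus.shiftEquiv (P := P) (j := 0)) (fun _ _ => (1 : 𝔸ˣ)) η P.d (τ : 𝔸 →ₗ[ℂ] ℂ)) ∘ R := by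
      funext Y'; rw [Function.comp_apply, hR]
    rw [e]; exact hV.comp R.differentiable
  refine hasFDerivAt_of_line_certificate BE _ (hΦ Y) (W₀ Y) fun δ => ?_
  -- the line `t ↦ Y + tδ`, read as configurations
  have hg : Differentiable ℂ (fun t : ℂ => (fun μ (x : Site P 0) => Y ⟨x, μ⟩) + t • fun μ (x : Site P 0) => δ ⟨x, μ⟩) :=
    (differentiable_const _).add (differentiable_id.smul_const _)
  have hcomp : DifferentiableAt ℂ (fun t : ℂ => V0 (LatticeFieldCalculus.shiftEquiv (P := P) (j := 0)) (fun _ _ => (1 : 𝔸ˣ)) η P.d (τ : 𝔸 →ₗ[ℂ] ℂ)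
      ((fun μ x => Y ⟨x, μ⟩) + t • fun μ x => δ ⟨x, μ⟩)) 0 :=
    (hV _).comp (0 : ℂ) (hg 0)
  have h := hcomp.hasDerivAt
  rw [← hcert δ, ← hBE] at h
  exact h

end Frechet

/-! ## §4  g0's V₀-current, repackaged with its Fréchet certificate -/

section Package

variable {P : Params}
variable {𝔸 : Type*} [NormedRing 𝔸] [NormedAlgebra ℂ 𝔸] [CompleteSpace 𝔸] [NormOneClass 𝔸] [StarRing 𝔸] [StarModule ℂ 𝔸]
  [FiniteDimensional ℂ 𝔸]

/-- ★★ **THE V₀-CURRENT OF RECORD AT THE FLAT BACKGROUND WITH ITS FRÉCHET CERTIFICATE** (one level `k`, `η = L^{−k}`): for every `Params` with `4 ≤ d` and fibre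
letters `ρ, τ` (dualising, tracial, `*`-compatible, contractive) there are a site dictionary `e`, a map `W₀` on `PBond P 0 → 𝔸` and a continuous bilinear `BE`
such that: `e` intertwines the shifts; `BE` IS the pairing (27); g0's pointwise (98)-slot `r < 1/16 ⇒ ‖W₀ Y b‖ ≤ (d−1)‖ρ‖(64+138‖τ‖)·r²` under the two size
letters; `W₀` is differentiable; and `D(V₀[shifts, 1])(Y) = BE(W₀ Y, ·)` at EVERY `Y` — the input `(Φ₀, g₀, BE)` of brick 8's `hasFDerivAt_sectF_VC_pair` at the chart
point `TA′`.  g0's `exists_W_V0_flat` + §2 + §3. [cite: Balaban1985Variational, (26)–(27) p.282, (90)–(96) pp.291–292, (98) p.293, (63) p.287, (158) p.302] -/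
theorem exists_V0_current_frechet_flat (P : Params) (hd : 4 ≤ P.d) (k : ℕ) [Fact ((0 : ℝ) < (P.L : ℝ))] [Fact ((0 : ℝ) < ((P.L : ℝ))⁻¹ ^ k)]
    (ρ : (𝔸 →L[ℂ] ℂ) →L[ℂ] 𝔸) (τ : 𝔸 →L[ℂ] ℂ) (hρ : ∀ (ℓ : 𝔸 →L[ℂ] ℂ) (X : 𝔸), τ (ρ ℓ * X) = ℓ X)
    (hτ : ∀ a b : 𝔸, τ (a * b) = τ (b * a)) (hτs : ∀ a : 𝔸, τ (star a) = starRingEnd ℂ (τ a)) (hτ1 : ∀ X : 𝔸, ‖τ X‖ ≤ ‖X‖) :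
    ∃ (e : Site P 0 ≃ TSite P.d (fun _ => P.sitesPerDir 0)) (W₀ : (PBond P 0 → 𝔸) → (PBond P 0 → 𝔸))
      (BE : (PBond P 0 → 𝔸) →L[ℂ] (PBond P 0 → 𝔸) →L[ℂ] ℂ),
      (∀ (x : Site P 0) (μ : Fin P.d), e (x.shift μ) = B9SectCLatticeCarrier.shift μ (e x)) ∧
      (∀ (Y : PBond P 0 → 𝔸) (b : PBond P 0), W₀ Y b =
        NegSup.equiv _ 𝔸 (curV0 (L := (P.L : ℝ)) (η := ((P.L : ℝ))⁻¹ ^ k)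
          (lev₀ := fun _ : Bond P.d (fun _ => P.sitesPerDir 0) => k) (lev₁ := fun _ : Bond P.d (fun _ => P.sitesPerDir 0) × Fin P.d => k)
          (Dc := nabla115 (((P.L : ℝ))⁻¹ ^ k) (1 : Bond P.d (fun _ => P.sitesPerDir 0) → 𝔸ˣ)) ρ τ 1
          ((JetSup.equiv _ _ _).symm fun b' => Y ⟨e.symm b'.1, b'.2⟩)) (e b.src, b.dir)) ∧
      (∀ Y δ : PBond P 0 → 𝔸, BE Y δ = bondPair (((P.L : ℝ))⁻¹ ^ k) P.d (τ : 𝔸 →ₗ[ℂ] ℂ) (fun μ x => Y ⟨x, μ⟩) (fun μ x => δ ⟨x, μ⟩)) ∧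
      (∀ (Y : PBond P 0 → 𝔸) (r : ℝ), r < 1 / 16 → (∀ b, ‖Y b‖ ≤ r) →
        (∀ (s : Site P 0) (μ ν : Fin P.d), (P.L : ℝ) ^ k * ‖Y ⟨s.shift ν, μ⟩ - Y ⟨s, μ⟩‖ ≤ r) →
        ∀ b, ‖W₀ Y b‖ ≤ (((P.d - 1 : ℕ) : ℝ) * ‖ρ‖ * (64 + 138 * ‖τ‖)) * r ^ 2) ∧
      Differentiable ℂ W₀ ∧
      (∀ Y : PBond P 0 → 𝔸, HasFDerivAt (fun Y' : PBond P 0 → 𝔸 =>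
          V0 (LatticeFieldCalculus.shiftEquiv (P := P) (j := 0)) (fun _ _ => (1 : 𝔸ˣ)) (((P.L : ℝ))⁻¹ ^ k) P.d (τ : 𝔸 →ₗ[ℂ] ℂ)
            (fun μ x => Y' ⟨x, μ⟩)) (BE (W₀ Y)) Y) := by
  obtain ⟨e, W₀, he, hdef, hWq, hWd, -, hcert⟩ := exists_W_V0_flat P hd k ρ τ hρ hτ hτs hτ1
  obtain ⟨BE, hBE⟩ := exists_bondPairCLM (P := P) (𝔸 := 𝔸) 0 (((P.L : ℝ))⁻¹ ^ k) P.d (τ : 𝔸 →ₗ[ℂ] ℂ)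
  have hη : ((P.L : ℝ))⁻¹ ^ k ≠ 0 := (Fact.out : (0 : ℝ) < ((P.L : ℝ))⁻¹ ^ k).ne'
  exact ⟨e, W₀, BE, he, hdef, hBE, hWq, hWd, fun Y => hasFDerivAt_V0_of_line_certificate hd hη τ hτ BE hBE W₀ Y (hcert Y)⟩


/-- ★★ **THE SAME WITH THE RECORD's MULTI-LEVEL WEIGHTS** (g0's `K0Stub1V0SlotAtRecordLevels.exists_W_V0_flat_levOf`, p590049): for any one-step-collared domain
sequence `Ω` at height `k` and the weights `w m b = ((L^{j(b)})·L^{−k})^m`, `j(b) = levOf Ω k b₋` (the weights of k0-s1-w1's `existsUnique_smallSolution158_recordDom`):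
`∃ e W₀ BE` with the dictionary law, `BE` = (27), the WEIGHTED pointwise (98)-slot `w₃(b)‖W₀ Y b‖ ≤ (64(d−1)L⁶‖ρ‖ + (d−1)L⁶(136+2L²)‖ρ‖‖τ‖)·r²` under the weighted
size letters at `r < 1/16`, `Differentiable ℂ W₀`, and `∀ Y, HasFDerivAt V₀ (BE (W₀ Y)) Y`. [cite: Balaban1985Variational, (115) p.294, (152) p.301, (98) p.293, (63) p.287] -/
theorem exists_V0_current_frechet_flat_levOf (P : Params) (hd : 4 ≤ P.d) (k : ℕ) [Fact ((0 : ℝ) < (P.L : ℝ))]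
    [Fact ((0 : ℝ) < ((P.L : ℝ))⁻¹ ^ k)] (Ω : ℕ → Set (Site P 0))
    (hcollar : ∀ (j : ℕ) (x : Site P 0) (ν : Fin P.d), x ∈ Ω (j + 1) → x.shift ν ∈ Ω j ∧ x.unshift ν ∈ Ω j)
    (w : ℕ → PBond P 0 → ℝ) (hw : ∀ m b, w m b = ((P.L : ℝ) ^ levOf Ω k b.src * ((P.L : ℝ)⁻¹) ^ k) ^ m)
    (ρ : (𝔸 →L[ℂ] ℂ) →L[ℂ] 𝔸) (τ : 𝔸 →L[ℂ] ℂ) (hρ : ∀ (ℓ : 𝔸 →L[ℂ] ℂ) (X : 𝔸), τ (ρ ℓ * X) = ℓ X)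
    (hτ : ∀ a b : 𝔸, τ (a * b) = τ (b * a)) (hτs : ∀ a : 𝔸, τ (star a) = starRingEnd ℂ (τ a)) (hτ1 : ∀ X : 𝔸, ‖τ X‖ ≤ ‖X‖) :
    ∃ (e : Site P 0 ≃ TSite P.d (fun _ => P.sitesPerDir 0)) (W₀ : (PBond P 0 → 𝔸) → (PBond P 0 → 𝔸))
      (BE : (PBond P 0 → 𝔸) →L[ℂ] (PBond P 0 → 𝔸) →L[ℂ] ℂ),
      (∀ (x : Site P 0) (μ : Fin P.d), e (x.shift μ) = B9SectCLatticeCarrier.shift μ (e x)) ∧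
      (∀ (Y : PBond P 0 → 𝔸) (b : PBond P 0), W₀ Y b =
        NegSup.equiv _ 𝔸 (curV0 (L := (P.L : ℝ)) (η := ((P.L : ℝ))⁻¹ ^ k)
          (lev₀ := fun b' : Bond P.d (fun _ => P.sitesPerDir 0) => levOf (fun j => e.symm ⁻¹' Ω j) k b'.1)
          (lev₁ := fun p : Bond P.d (fun _ => P.sitesPerDir 0) × Fin P.d => levOf (fun j => e.symm ⁻¹' Ω j) k p.1.1)
          (Dc := nabla115 (((P.L : ℝ))⁻¹ ^ k) (1 : Bond P.d (fun _ => P.sitesPerDir 0) → 𝔸ˣ)) ρ τ 1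
          ((JetSup.equiv _ _ _).symm fun b' => Y ⟨e.symm b'.1, b'.2⟩)) (e b.src, b.dir)) ∧
      (∀ Y δ : PBond P 0 → 𝔸, BE Y δ = bondPair (((P.L : ℝ))⁻¹ ^ k) P.d (τ : 𝔸 →ₗ[ℂ] ℂ) (fun μ x => Y ⟨x, μ⟩) (fun μ x => δ ⟨x, μ⟩)) ∧
      (∀ (Y : PBond P 0 → 𝔸) (r : ℝ), r < 1 / 16 → (∀ b, w 1 b * ‖Y b‖ ≤ r) →
        (∀ (b : PBond P 0) (ν : Fin P.d), w 2 b * (P.L : ℝ) ^ k * ‖Y ⟨b.src.shift ν, b.dir⟩ - Y b‖ ≤ r) →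
        ∀ b, w 3 b * ‖W₀ Y b‖ ≤
          (64 * ((P.d - 1 : ℕ) : ℝ) * ((P.L : ℝ) ^ 2) ^ 3 * ‖ρ‖
            + ((P.d - 1 : ℕ) : ℝ) * ((P.L : ℝ) ^ 2) ^ 3 * (136 + 2 * (P.L : ℝ) ^ 2) * ‖ρ‖ * ‖τ‖) * r ^ 2) ∧
      Differentiable ℂ W₀ ∧
      (∀ Y : PBond P 0 → 𝔸, HasFDerivAt (fun Y' : PBond P 0 → 𝔸 =>
          V0 (LatticeFieldCalculus.shiftEquiv (P := P) (j := 0)) (fun _ _ => (1 : 𝔸ˣ)) (((P.L : ℝ))⁻¹ ^ k) P.d (τ : 𝔸 →ₗ[ℂ] ℂ)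
            (fun μ x => Y' ⟨x, μ⟩)) (BE (W₀ Y)) Y) := by
  obtain ⟨e, W₀, he, hdef, hWq, hWd, hcert⟩ := exists_W_V0_flat_levOf P hd k Ω hcollar w hw ρ τ hρ hτ hτs hτ1
  obtain ⟨BE, hBE⟩ := exists_bondPairCLM (P := P) (𝔸 := 𝔸) 0 (((P.L : ℝ))⁻¹ ^ k) P.d (τ : 𝔸 →ₗ[ℂ] ℂ)
  have hη : ((P.L : ℝ))⁻¹ ^ k ≠ 0 := (Fact.out : (0 : ℝ) < ((P.L : ℝ))⁻¹ ^ k).ne'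
  exact ⟨e, W₀, BE, he, hdef, hBE, hWq, hWd, fun Y => hasFDerivAt_V0_of_line_certificate hd hη τ hτ BE hBE W₀ Y (hcert Y)⟩

end Package

end Summit.QuantumFields.YangMills.Theorems.K0Stub1V0CurrentFrechet

end
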